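import Summits.AnomalousDissipation.AnomalousDissipation.Theorems.MomentParityMomentLadderErgodicPrelim

/-!
# Crux `MomentParity.MomentLadder` (stmt-AnomalousDissipation-11463), line `Sketch`: BIRKHOFF SELECTION of one good datum (3b/4)

From an admissible level-`N` law (probability, level-`N`, supported in `‖u‖ ≤ R`, all-order stationary, `κ`-resolved, energy
`≤ E₀`, dissipation `≥ ε`), Birkhoff's theorem on the phase law (`…PhaseLaw`, `…TimeMeans`, `…ErgodicPrelim`) selects ONE
datum whose running time means converge, with dissipation/energy ratio `> ε/(2E₀)` and unresolved-enstrophy tails below the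
LEVEL-FREE re-indexed schedule `n ↦ κ((n+1)2^(n+1)L)` (`exists_good_datum`; thresholds: `goodDatum_thresholds_exist`).
Folklore (Birkhoff 1931; Krylov–Bogoliubov 1937; Foias–Manley–Rosa–Temam 2001 Ch. IV).
-/

set_option linter.dupNamespace false

noncomputable section

namespace Summit.AnomalousDissipation.AnomalousDissipation.Theorems.MomentLadder

open MeasureTheory Filter Topology Set Function UnitAddTorus intervalIntegral
open scoped ENNReal
open Literature.Analysis.FunctionSpaces Literature.Analysis.FluidPDE
open Summit.AnomalousDissipation.AnomalousDissipation.Theorems.QuarticGate.Negative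
open Summit.AnomalousDissipation.AnomalousDissipation.Theorems.CubicParityLoud.Negative (T3 R3 H3 L2T3)
open Summit.AnomalousDissipation.AnomalousDissipation.Theorems.MomentLadder.Negative (IsSupported IsResolved)

/-! ## §C Selection of one good datum -/

section Select

variable {ν : ℝ} {f : T3 → R3} {N : ℕ} {R : ℝ} {μ : Measure H3}

set_option maxHeartbeats 400000 in
/-- **SELECTION OF A GOOD DATUM (Birkhoff + UI).** For an admissible `κ`-resolved law at `(ν, f, N, R)` with energy `≤ E₀`,
dissipation `≥ ε` and level-free thresholds `ν (8π²κ(n₀)²R²/L + 2/(n₀+1)) < ε/2`: some datum with vanishing mean mode and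
confined orbit has convergent running time means of energy (`e`) and band enstrophy (`z`) with `(ε/(2E₀)) e < ν z`, and of
every unresolved tail beyond `κ((n+1)2^(n+1)L)` with limit `≤ 1/(n+1)`. [folklore] -/
theorem exists_good_datum [IsProbabilityMeasure μ] (hν : 0 < ν) (hf : Torus.IsSmooth f) (hf0 : Torus.HasZeroMean f)
    (hL : ∀ᵐ u ∂μ, IsLevel N u) (hB : ∀ᵐ u ∂μ, ‖u‖ ≤ R) (hS : ∀ d : ℕ, IsPolyStationary ν f N d μ)
    {κ : ℕ → ℕ} (hres : IsResolved κ μ) {E₀ ε : ℝ} (hE₀ : 0 < E₀) (hε : 0 < ε)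
    (hE : Torus.ensembleEnergy μ ≤ E₀) (hD : ε ≤ Torus.ensembleDissipation ν μ)
    {L n₀ : ℕ} (hL1 : 1 ≤ L)
    (hthr : ν * (8 * Real.pi ^ 2 * ((κ n₀ : ℕ) : ℝ) ^ 2 * R ^ 2 / L + 2 * ((n₀ : ℝ) + 1)⁻¹) < ε / 2) :
    ∃ x : ↥(galerkinSubspace (Torus.freqBall (d := Fin 3) N)),
      (x : ↥(Torus.freqBall (d := Fin 3) N) → EuclideanSpace ℂ (Fin 3)) ⟨0, Torus.zero_mem_freqBall N⟩ = 0 ∧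
      (∀ t, 0 ≤ t → ∑ k ∈ Torus.freqBall N, ‖Torus.coeffExt (Torus.freqBall N)
        ((galerkinPhaseFlow ν (fourierRestrict (Torus.freqBall N) f) t x :
          ↥(galerkinSubspace (Torus.freqBall (d := Fin 3) N))) :
            ↥(Torus.freqBall (d := Fin 3) N) → EuclideanSpace ℂ (Fin 3)) k‖ ^ 2 ≤ R ^ 2) ∧
      ∃ e z : ℝ, ε / (2 * E₀) * e < ν * z ∧
        Tendsto (fun n : ℕ => (n : ℝ)⁻¹ * ∫ t in (0 : ℝ)..(n : ℝ),
          ∑ k ∈ Torus.freqBall N, ‖Torus.coeffExt (Torus.freqBall N)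
            ((galerkinPhaseFlow ν (fourierRestrict (Torus.freqBall N) f) t x :
              ↥(galerkinSubspace (Torus.freqBall (d := Fin 3) N))) :
                ↥(Torus.freqBall (d := Fin 3) N) → EuclideanSpace ℂ (Fin 3)) k‖ ^ 2) atTop (𝓝 e) ∧
        Tendsto (fun n : ℕ => (n : ℝ)⁻¹ * ∫ t in (0 : ℝ)..(n : ℝ),
          4 * Real.pi ^ 2 * ∑ k ∈ Torus.freqBall N, Torus.freqNormSq k * ‖Torus.coeffExt (Torus.freqBall N)
            ((galerkinPhaseFlow ν (fourierRestrict (Torus.freqBall N) f) t x :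
              ↥(galerkinSubspace (Torus.freqBall (d := Fin 3) N))) :
                ↥(Torus.freqBall (d := Fin 3) N) → EuclideanSpace ℂ (Fin 3)) k‖ ^ 2) atTop (𝓝 z) ∧
        ∀ n : ℕ, ∃ τ : ℝ, τ ≤ ((n : ℝ) + 1)⁻¹ ∧
          Tendsto (fun i : ℕ => (i : ℝ)⁻¹ * ∫ t in (0 : ℝ)..(i : ℝ),
            (4 * Real.pi ^ 2 * ∑ k ∈ Torus.freqBall N, Torus.freqNormSq k * ‖Torus.coeffExt (Torus.freqBall N)
              ((galerkinPhaseFlow ν (fourierRestrict (Torus.freqBall N) f) t x :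
                ↥(galerkinSubspace (Torus.freqBall (d := Fin 3) N))) :
                  ↥(Torus.freqBall (d := Fin 3) N) → EuclideanSpace ℂ (Fin 3)) k‖ ^ 2 -
             4 * Real.pi ^ 2 * ∑ k ∈ Torus.freqBall (κ ((n + 1) * 2 ^ (n + 1) * L)), Torus.freqNormSq k *
              ‖Torus.coeffExt (Torus.freqBall N)
                ((galerkinPhaseFlow ν (fourierRestrict (Torus.freqBall N) f) t x :
                  ↥(galerkinSubspace (Torus.freqBall (d := Fin 3) N))) :
                    ↥(Torus.freqBall (d := Fin 3) N) → EuclideanSpace ℂ (Fin 3)) k‖ ^ 2)) atTop (𝓝 τ) := by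
  classical
  have hSsym : ∀ k ∈ Torus.freqBall (d := Fin 3) N, -k ∈ Torus.freqBall N := Torus.neg_mem_freqBall_of_mem
  have hg : Torus.IsRealCoeff (fourierRestrict (Torus.freqBall (d := Fin 3) N) f) :=
    Torus.isRealCoeff_mFourierCoeff hf.integrable
  haveI : (ae μ).NeBot := ae_neBot.2 (IsProbabilityMeasure.ne_zero μ)
  obtain ⟨u₀, hu₀⟩ := hB.exists
  have hR : 0 ≤ R := (norm_nonneg _).trans hu₀
  have hμK : ∀ᵐ u ∂μ, u ∈ {u : H3 | IsLevel N u ∧ ‖u‖ ≤ R} := (hL.and hB).mono fun u hu => hu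
  have hΘc := continuous_coeffPhase N
  set m : Measure ↥(galerkinSubspace (Torus.freqBall (d := Fin 3) N)) :=
    μ.map fun u : H3 => (⟨fourierRestrict (Torus.freqBall N) (u.1 : T3 → R3),
      MomentParity.fourierRestrict_coe_mem_galerkinSubspace N u⟩ :
        ↥(galerkinSubspace (Torus.freqBall (d := Fin 3) N))) with hm_def
  haveI : IsProbabilityMeasure m := Measure.isProbabilityMeasure_map hΘc.measurable.aemeasurable
  have hinv : ∀ s, 0 ≤ s → m.map (galerkinPhaseFlow ν (fourierRestrict (Torus.freqBall N) f) s) = m :=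
    fun s hs => map_galerkinPhaseFlow_phaseLaw hν hf hf0 hL hB hS hs
  have hT : MeasurePreserving (galerkinPhaseFlow ν (fourierRestrict (Torus.freqBall N) f) 1) m m :=
    measurePreserving_galerkinPhaseFlow_phaseLaw hν hf hf0 hL hB hS zero_le_one
  have hconf := ae_phaseLaw_confined (N := N) (R := R) hν hf hf0 hL hB hS
  have hint_map : ∀ (G : ↥(galerkinSubspace (Torus.freqBall (d := Fin 3) N)) → ℝ), Continuous G →
      ∫ x, G x ∂m = ∫ u, G (⟨fourierRestrict (Torus.freqBall N) (u.1 : T3 → R3),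
        MomentParity.fourierRestrict_coe_mem_galerkinSubspace N u⟩) ∂μ :=
    fun G hG => integral_map hΘc.measurable.aemeasurable hG.aestronglyMeasurable
  set En : ↥(galerkinSubspace (Torus.freqBall (d := Fin 3) N)) → ℝ := fun x =>
    ∑ k ∈ Torus.freqBall N, ‖Torus.coeffExt (Torus.freqBall N)
      (x : ↥(Torus.freqBall (d := Fin 3) N) → EuclideanSpace ℂ (Fin 3)) k‖ ^ 2 with hEn
  set Bd : ℕ → ↥(galerkinSubspace (Torus.freqBall (d := Fin 3) N)) → ℝ := fun Lv x =>
    4 * Real.pi ^ 2 * ∑ k ∈ Torus.freqBall Lv, Torus.freqNormSq k * ‖Torus.coeffExt (Torus.freqBall N)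
      (x : ↥(Torus.freqBall (d := Fin 3) N) → EuclideanSpace ℂ (Fin 3)) k‖ ^ 2 with hBd
  set ms : ℕ → ℕ := fun n => (n + 1) * 2 ^ (n + 1) * L with hms
  set Tl : ℕ → ↥(galerkinSubspace (Torus.freqBall (d := Fin 3) N)) → ℝ := fun n x => Bd N x - Bd (κ (ms n)) x with hTl
  have hcoef : ∀ k : Fin 3 → ℤ, Continuous fun x : ↥(galerkinSubspace (Torus.freqBall (d := Fin 3) N)) =>
      ‖Torus.coeffExt (Torus.freqBall N) (x : ↥(Torus.freqBall (d := Fin 3) N) → EuclideanSpace ℂ (Fin 3)) k‖ ^ 2 := by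
    intro k
    by_cases hk : k ∈ Torus.freqBall N
    · simp_rw [Torus.coeffExt_of_mem _ hk]
      exact (((continuous_apply _).comp continuous_subtype_val).norm).pow 2
    · simp_rw [Torus.coeffExt_of_not_mem _ hk, norm_zero]
      exact continuous_const
  have hEnc : Continuous En := continuous_finsetSum _ fun k _ => hcoef k
  have hBdc : ∀ Lv, Continuous (Bd Lv) := fun Lv =>
    continuous_const.mul (continuous_finsetSum _ fun k _ => continuous_const.mul (hcoef k))
  have hTlc : ∀ n, Continuous (Tl n) := fun n => (hBdc N).sub (hBdc _)
  have hEn0 : ∀ x, 0 ≤ En x := fun x => Finset.sum_nonneg fun k _ => sq_nonneg _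
  have hBd0 : ∀ Lv x, 0 ≤ Bd Lv x := fun Lv x =>
    mul_nonneg (by positivity) (Finset.sum_nonneg fun k _ => mul_nonneg (Torus.freqNormSq_nonneg k) (sq_nonneg _))
  have hBdle : ∀ Lv x, Bd Lv x ≤ Bd N x := fun Lv x => coeffBand_le_coeffBand Lv _
  have hTl0 : ∀ n x, 0 ≤ Tl n x := fun n x => sub_nonneg.2 (hBdle _ x)
  have hBdN : ∀ x, Bd N x ≤ 4 * Real.pi ^ 2 * (N : ℝ) ^ 2 * En x := fun x => coeffBand_le_sq_mul _
  set C : ℝ := 4 * Real.pi ^ 2 * (N : ℝ) ^ 2 * R ^ 2 + R ^ 2 with hC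
  have hbounds : ∀ᵐ x ∂m, ∀ s, 0 ≤ s →
      |En (galerkinPhaseFlow ν (fourierRestrict (Torus.freqBall N) f) s x)| ≤ C ∧
      (∀ Lv, |Bd Lv (galerkinPhaseFlow ν (fourierRestrict (Torus.freqBall N) f) s x)| ≤ C) ∧
      ∀ n, |Tl n (galerkinPhaseFlow ν (fourierRestrict (Torus.freqBall N) f) s x)| ≤ C := by
    filter_upwards [hconf] with x hx s hs
    have he : En (galerkinPhaseFlow ν (fourierRestrict (Torus.freqBall N) f) s x) ≤ R ^ 2 := hx.2 s hs
    have h4 : (0 : ℝ) ≤ 4 * Real.pi ^ 2 * (N : ℝ) ^ 2 := by positivity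
    have hZ : Bd N (galerkinPhaseFlow ν (fourierRestrict (Torus.freqBall N) f) s x) ≤ 4 * Real.pi ^ 2 * (N : ℝ) ^ 2 * R ^ 2 :=
      (hBdN _).trans (by nlinarith)
    have hR2 : (0 : ℝ) ≤ R ^ 2 := sq_nonneg _
    have hCge : 4 * Real.pi ^ 2 * (N : ℝ) ^ 2 * R ^ 2 ≤ C := by rw [hC]; linarith
    refine ⟨?_, fun Lv => ?_, fun n => ?_⟩
    · rw [abs_of_nonneg (hEn0 _)]; exact he.trans (by rw [hC]; nlinarith)
    · rw [abs_of_nonneg (hBd0 _ _)]; exact ((hBdle Lv _).trans hZ).trans hCge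
    · rw [abs_of_nonneg (hTl0 _ _)]
      exact ((sub_le_self _ (hBd0 _ _)).trans hZ).trans hCge
  have hbEn : ∀ᵐ x ∂m, ∀ s, 0 ≤ s → |En (galerkinPhaseFlow ν (fourierRestrict (Torus.freqBall N) f) s x)| ≤ C :=
    hbounds.mono fun x hx s hs => (hx s hs).1
  have hbBd : ∀ Lv, ∀ᵐ x ∂m, ∀ s, 0 ≤ s → |Bd Lv (galerkinPhaseFlow ν (fourierRestrict (Torus.freqBall N) f) s x)| ≤ C :=
    fun Lv => hbounds.mono fun x hx s hs => (hx s hs).2.1 Lv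
  have hbTl : ∀ n, ∀ᵐ x ∂m, ∀ s, 0 ≤ s → |Tl n (galerkinPhaseFlow ν (fourierRestrict (Torus.freqBall N) f) s x)| ≤ C :=
    fun n => hbounds.mono fun x hx s hs => (hx s hs).2.2 n
  have hlev_coef : ∀ᵐ u ∂μ, ∀ k, Torus.coeffExt (Torus.freqBall N) (fourierRestrict (Torus.freqBall N) (u.1 : T3 → R3)) k =
      mFourierCoeff (EuclideanSpace.complexify ∘ (u.1 : T3 → R3)) k :=
    hL.mono fun u hu k => coeffExt_fourierRestrict_of_isLevel hu k
  have hBd_map : ∀ Lv, ∫ x, Bd Lv x ∂m = ∫ u, (4 * Real.pi ^ 2 * ∑ k ∈ Torus.freqBall Lv, Torus.freqNormSq k *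
      ‖mFourierCoeff (EuclideanSpace.complexify ∘ (u.1 : T3 → R3)) k‖ ^ 2) ∂μ := by
    intro Lv
    rw [hint_map _ (hBdc Lv)]
    refine integral_congr_ae (hlev_coef.mono fun u hu => ?_)
    simp only [hBd]
    simp_rw [hu]
  have hEn_int : ∫ x, En x ∂m ≤ E₀ := by
    rw [hint_map _ hEnc]
    refine le_trans (integral_mono_of_nonneg (Eventually.of_forall fun u => hEn0 _)
      (MomentLadder.Negative.integrable_norm_pow_of_isSupported hB 2) (Eventually.of_forall fun u => coeffEnergy_le_norm_sq u)) ?_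
    exact hE
  have hZ_int : ε ≤ ν * ∫ x, Bd N x ∂m := by
    rw [hBd_map N]
    have hDμ : Torus.ensembleDissipation ν μ = ν * ∫ u, (4 * Real.pi ^ 2 * ∑ k ∈ Torus.freqBall N, Torus.freqNormSq k *
        ‖mFourierCoeff (EuclideanSpace.complexify ∘ (u.1 : T3 → R3)) k‖ ^ 2) ∂μ := by
      rw [Torus.ensembleDissipation, Torus.ensembleEnstrophy, MomentParityMomentClosure.lintegral_eGradNormSq_eq hR hμK,
        ENNReal.toReal_ofReal (integral_nonneg fun u => MomentParityMomentClosure.bandEnstrophy_nonneg _ u)]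
    rw [← hDμ]; exact hD
  have hTl_int : ∀ n, ∫ x, Tl n x ∂m ≤ ((ms n : ℝ) + 1)⁻¹ := by
    intro n
    have hsub : ∫ x, Tl n x ∂m = ∫ x, Bd N x ∂m - ∫ x, Bd (κ (ms n)) x ∂m := by
      simp only [hTl]
      exact integral_sub (integrable_obs_of_confined (hBdc N) (hbBd N)) (integrable_obs_of_confined (hBdc _) (hbBd _))
    rw [hsub, hBd_map, hBd_map]
    have h := hres (ms n)
    rw [MomentParityMomentClosure.lintegral_eGradNormSq_eq hR hμK,
      MomentParityMomentClosure.lintegral_eGradNormSq_fourierTruncate_eq hR hμK (κ (ms n)),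
      MomentParityMomentClosure.ofReal_le_ofReal_add_inv_iff
        (integral_nonneg fun u => MomentParityMomentClosure.bandEnstrophy_nonneg _ u) (ms n)] at h
    exact h
  have hTm_nonneg : ∀ (G : ↥(galerkinSubspace (Torus.freqBall (d := Fin 3) N)) → ℝ), (∀ x, 0 ≤ G x) →
      ∀ x i, 0 ≤ birkhoffAverage ℝ (galerkinPhaseFlow ν (fourierRestrict (Torus.freqBall N) f) 1)
        (fun y => ∫ s in (0 : ℝ)..1, G (galerkinPhaseFlow ν (fourierRestrict (Torus.freqBall N) f) s y)) i x := by
    intro G hG x i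
    simp only [birkhoffAverage, birkhoffSum]
    exact smul_nonneg (inv_nonneg.2 (Nat.cast_nonneg _))
      (Finset.sum_nonneg fun k _ => intervalIntegral.integral_nonneg zero_le_one fun s _ => hG _)
  obtain ⟨Est, hEsti, -, hEstint, hEconv⟩ := Literature.Dynamics.Ergodic.birkhoff_ergodic_theorem_holds m _ hT _
    (integrable_timeMean hν.le hg hEnc hbEn)
  obtain ⟨Zst, hZsti, -, hZstint, hZconv⟩ := Literature.Dynamics.Ergodic.birkhoff_ergodic_theorem_holds m _ hT _
    (integrable_timeMean hν.le hg (hBdc N) (hbBd N))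
  have hTl_birk : ∀ n, ∃ Tst : ↥(galerkinSubspace (Torus.freqBall (d := Fin 3) N)) → ℝ, Integrable Tst m ∧
      Tst ∘ (galerkinPhaseFlow ν (fourierRestrict (Torus.freqBall N) f) 1) = Tst ∧
      ∫ x, Tst x ∂m = ∫ x, (∫ s in (0 : ℝ)..1, Tl n (galerkinPhaseFlow ν (fourierRestrict (Torus.freqBall N) f) s x)) ∂m ∧
      ∀ᵐ x ∂m, Tendsto (fun i : ℕ => birkhoffAverage ℝ (galerkinPhaseFlow ν (fourierRestrict (Torus.freqBall N) f) 1)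
        (fun y => ∫ s in (0 : ℝ)..1, Tl n (galerkinPhaseFlow ν (fourierRestrict (Torus.freqBall N) f) s y)) i x) atTop (𝓝 (Tst x)) :=
    fun n => Literature.Dynamics.Ergodic.birkhoff_ergodic_theorem_holds m _ hT _ (integrable_timeMean hν.le hg (hTlc n) (hbTl n))
  choose Tst hTsti hTstinv hTstint hTconv using hTl_birk
  have hEst_le : ∫ x, Est x ∂m ≤ E₀ := by
    rw [hEstint, integral_timeMean_eq hν.le hg hinv hEnc hbEn]; exact hEn_int
  have hZst_ge : ε ≤ ν * ∫ x, Zst x ∂m := by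
    rw [hZstint, integral_timeMean_eq hν.le hg hinv (hBdc N) (hbBd N)]; exact hZ_int
  have hTst_le : ∀ n, ∫ x, Tst n x ∂m ≤ ((ms n : ℝ) + 1)⁻¹ := fun n => by
    rw [hTstint n, integral_timeMean_eq hν.le hg hinv (hTlc n) (hbTl n)]; exact hTl_int n
  have hEst0 : 0 ≤ᵐ[m] Est := hEconv.mono fun x hx => ge_of_tendsto' hx fun i => hTm_nonneg En hEn0 x i
  have hTst0 : ∀ n, 0 ≤ᵐ[m] Tst n := fun n => (hTconv n).mono fun x hx => ge_of_tendsto' hx fun i => hTm_nonneg _ (hTl0 n) x i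
  set Tm : ℕ → ↥(galerkinSubspace (Torus.freqBall (d := Fin 3) N)) → ℝ := fun n => (hTsti n).aestronglyMeasurable.mk (Tst n) with hTm
  have hTm_meas : ∀ n, Measurable (Tm n) := fun n => (hTsti n).aestronglyMeasurable.stronglyMeasurable_mk.measurable
  have hTm_ae : ∀ n, Tst n =ᵐ[m] Tm n := fun n => (hTsti n).aestronglyMeasurable.ae_eq_mk
  set Bset : Set ↥(galerkinSubspace (Torus.freqBall (d := Fin 3) N)) := ⋃ n : ℕ, {x | ((n : ℝ) + 1)⁻¹ < Tm n x} with hBset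
  have hBn_meas : ∀ n : ℕ, MeasurableSet {x : ↥(galerkinSubspace (Torus.freqBall (d := Fin 3) N)) | ((n : ℝ) + 1)⁻¹ < Tm n x} :=
    fun n => measurableSet_lt measurable_const (hTm_meas n)
  have hBmeas : MeasurableSet Bset := MeasurableSet.iUnion hBn_meas
  have hBinv : (galerkinPhaseFlow ν (fourierRestrict (Torus.freqBall N) f) 1) ⁻¹' Bset =ᵐ[m] Bset := by
    rw [hBset, preimage_iUnion]
    refine Filter.EventuallyEq.countable_iUnion fun n => ?_
    have hsets : ({x | ((n : ℝ) + 1)⁻¹ < Tm n x} : Set ↥(galerkinSubspace (Torus.freqBall (d := Fin 3) N))) =ᵐ[m]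
        {x | ((n : ℝ) + 1)⁻¹ < Tst n x} := by
      filter_upwards [hTm_ae n] with x hx
      simp only [eq_iff_iff]
      show ((n : ℝ) + 1)⁻¹ < Tm n x ↔ ((n : ℝ) + 1)⁻¹ < Tst n x
      rw [hx]
    have h2 : ((galerkinPhaseFlow ν (fourierRestrict (Torus.freqBall N) f) 1) ⁻¹' {x | ((n : ℝ) + 1)⁻¹ < Tst n x} :
        Set ↥(galerkinSubspace (Torus.freqBall (d := Fin 3) N))) =ᵐ[m] {x | ((n : ℝ) + 1)⁻¹ < Tst n x} := by
      rw [preimage_setOf_lt_of_invariant (hTstinv n)]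
    exact ((hT.quasiMeasurePreserving.preimage_ae_eq hsets).trans h2).trans hsets.symm
  have hBn_le : ∀ n : ℕ, m.real {x | ((n : ℝ) + 1)⁻¹ < Tm n x} ≤ (L : ℝ)⁻¹ * (2⁻¹) ^ (n + 1) := by
    intro n
    have hTmi : Integrable (Tm n) m := (hTsti n).congr (hTm_ae n)
    have hTm0 : 0 ≤ᵐ[m] Tm n := by filter_upwards [hTst0 n, hTm_ae n] with x h1 h2; rwa [← h2]
    have hmk := mul_meas_ge_le_integral_of_nonneg hTm0 hTmi (((n : ℝ) + 1)⁻¹)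
    have hintTm : ∫ x, Tm n x ∂m ≤ ((ms n : ℝ) + 1)⁻¹ := by rw [← integral_congr_ae (hTm_ae n)]; exact hTst_le n
    have hcn : (0 : ℝ) < (n : ℝ) + 1 := by positivity
    have hsub : m.real {x | ((n : ℝ) + 1)⁻¹ < Tm n x} ≤ m.real {x | ((n : ℝ) + 1)⁻¹ ≤ Tm n x} :=
      measureReal_mono (fun x hx => le_of_lt (show ((n : ℝ) + 1)⁻¹ < Tm n x from hx)) (measure_ne_top _ _)
    have h1 : m.real {x | ((n : ℝ) + 1)⁻¹ ≤ Tm n x} ≤ ((n : ℝ) + 1) * ((ms n : ℝ) + 1)⁻¹ := by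
      have := hmk.trans hintTm
      rw [inv_mul_le_iff₀ hcn] at this
      exact this
    refine hsub.trans (h1.trans ?_)
    -- `(n+1)/(ms n + 1) ≤ (n+1)/ms n = 1/(2^(n+1) L)`
    have hL0 : (0 : ℝ) < L := by exact_mod_cast hL1
    have hmsR : ((ms n : ℕ) : ℝ) = ((n : ℝ) + 1) * 2 ^ (n + 1) * L := by simp [hms]
    have hpos : (0 : ℝ) < ((n : ℝ) + 1) * 2 ^ (n + 1) * L := by positivity
    calc ((n : ℝ) + 1) * ((ms n : ℝ) + 1)⁻¹ ≤ ((n : ℝ) + 1) * (((n : ℝ) + 1) * 2 ^ (n + 1) * L)⁻¹ := by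
          rw [hmsR]
          gcongr
          linarith
      _ = (L : ℝ)⁻¹ * (2⁻¹) ^ (n + 1) := by
          rw [show ((n : ℝ) + 1) * 2 ^ (n + 1) * (L : ℝ) = ((n : ℝ) + 1) * (2 ^ (n + 1) * (L : ℝ)) by ring,
            mul_inv, ← mul_assoc, mul_inv_cancel₀ hcn.ne', one_mul, mul_inv, inv_pow, mul_comm]
  have hBsmall : m.real Bset ≤ (L : ℝ)⁻¹ := by
    have h1 : m Bset ≤ ∑' n : ℕ, m {x | ((n : ℝ) + 1)⁻¹ < Tm n x} := measure_iUnion_le _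
    have h2 : ∀ n : ℕ, m {x | ((n : ℝ) + 1)⁻¹ < Tm n x} ≤ ENNReal.ofReal ((L : ℝ)⁻¹) * (2⁻¹ : ℝ≥0∞) ^ (n + 1) := by
      intro n
      rw [← ofReal_measureReal (measure_ne_top _ _)]
      calc ENNReal.ofReal (m.real {x | ((n : ℝ) + 1)⁻¹ < Tm n x}) ≤ ENNReal.ofReal ((L : ℝ)⁻¹ * (2⁻¹) ^ (n + 1)) :=
            ENNReal.ofReal_le_ofReal (hBn_le n)
        _ = ENNReal.ofReal ((L : ℝ)⁻¹) * (2⁻¹ : ℝ≥0∞) ^ (n + 1) := by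
            rw [ENNReal.ofReal_mul (by positivity), ENNReal.ofReal_pow (by positivity),
              ENNReal.ofReal_inv_of_pos (by norm_num : (0 : ℝ) < 2), ENNReal.ofReal_ofNat]
    have h3 : ∑' n : ℕ, ENNReal.ofReal ((L : ℝ)⁻¹) * (2⁻¹ : ℝ≥0∞) ^ (n + 1) = ENNReal.ofReal ((L : ℝ)⁻¹) := by
      rw [ENNReal.tsum_mul_left, ENNReal.tsum_geometric_add_one, ENNReal.one_sub_inv_two, inv_inv,
        ENNReal.inv_mul_cancel (by norm_num) (by norm_num), mul_one]
    have h4 : m Bset ≤ ENNReal.ofReal ((L : ℝ)⁻¹) := (h1.trans (ENNReal.tsum_le_tsum h2)).trans_eq h3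
    rw [measureReal_def]
    exact (ENNReal.toReal_mono ENNReal.ofReal_ne_top h4).trans_eq (ENNReal.toReal_ofReal (by positivity))
  -- (5) the dissipation budget on the bad set and on its complement
  set κ₀ : ℝ := ε / (2 * E₀) with hκ₀
  have hκ₀0 : 0 ≤ κ₀ := by positivity
  have hZbari := integrable_timeMean hν.le hg (hBdc N) (hbBd N)
  have hh_int : Integrable (fun x => ν * Zst x - κ₀ * Est x) m := (hZsti.const_mul ν).sub (hEsti.const_mul κ₀)
  have htot : ε / 2 ≤ ∫ x, (ν * Zst x - κ₀ * Est x) ∂m := by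
    rw [integral_sub (hZsti.const_mul ν) (hEsti.const_mul κ₀), MeasureTheory.integral_const_mul, MeasureTheory.integral_const_mul]
    have h1 : κ₀ * ∫ x, Est x ∂m ≤ ε / 2 := by
      calc κ₀ * ∫ x, Est x ∂m ≤ κ₀ * E₀ := mul_le_mul_of_nonneg_left hEst_le hκ₀0
        _ = ε / 2 := by rw [hκ₀]; field_simp
    linarith
  have hbad : ∫ x in Bset, (ν * Zst x - κ₀ * Est x) ∂m < ε / 2 := by
    have h1 : ∫ x in Bset, (ν * Zst x - κ₀ * Est x) ∂m ≤ ν * ∫ x in Bset, Zst x ∂m := by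
      rw [← MeasureTheory.integral_const_mul]
      refine setIntegral_mono_ae hh_int.integrableOn (hZsti.const_mul ν).integrableOn ?_
      filter_upwards [hEst0] with x hx
      have : 0 ≤ κ₀ * Est x := mul_nonneg hκ₀0 hx
      linarith
    have h2 : ∫ x in Bset, Zst x ∂m = ∫ x in Bset, (∫ s in (0 : ℝ)..1,
        Bd N (galerkinPhaseFlow ν (fourierRestrict (Torus.freqBall N) f) s x)) ∂m :=
      setIntegral_birkhoffLimit_eq hT hZbari hZconv hBmeas hBinv
    have h3 := setIntegral_timeMean_le hν.le hg hinv (hBdc N) (hbBd N) hBmeas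
      (8 * Real.pi ^ 2 * ((κ n₀ : ℕ) : ℝ) ^ 2 * R ^ 2)
    have h4 : ∫ x, max (Bd N x - 8 * Real.pi ^ 2 * ((κ n₀ : ℕ) : ℝ) ^ 2 * R ^ 2) 0 ∂m ≤ 2 * ((n₀ : ℝ) + 1)⁻¹ := by
      rw [hint_map (fun x => max (Bd N x - 8 * Real.pi ^ 2 * ((κ n₀ : ℕ) : ℝ) ^ 2 * R ^ 2) 0)
        (((hBdc N).sub continuous_const).max continuous_const)]
      refine le_trans (le_of_eq (integral_congr_ae (hlev_coef.mono fun u hu => ?_)))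
        (integral_posPart_bandEnstrophy_le (N := N) hL hB hres n₀)
      simp only [hBd]
      simp_rw [hu]
    have hM0 : 0 ≤ 8 * Real.pi ^ 2 * ((κ n₀ : ℕ) : ℝ) ^ 2 * R ^ 2 := by positivity
    have h5 : ∫ x in Bset, Zst x ∂m ≤ 8 * Real.pi ^ 2 * ((κ n₀ : ℕ) : ℝ) ^ 2 * R ^ 2 / L + 2 * ((n₀ : ℝ) + 1)⁻¹ := by
      rw [h2]
      refine h3.trans (add_le_add ?_ h4)
      rw [div_eq_mul_inv]
      exact mul_le_mul_of_nonneg_left hBsmall hM0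
    calc ∫ x in Bset, (ν * Zst x - κ₀ * Est x) ∂m ≤ ν * ∫ x in Bset, Zst x ∂m := h1
      _ ≤ ν * (8 * Real.pi ^ 2 * ((κ n₀ : ℕ) : ℝ) ^ 2 * R ^ 2 / L + 2 * ((n₀ : ℝ) + 1)⁻¹) :=
          mul_le_mul_of_nonneg_left h5 hν.le
      _ < ε / 2 := hthr
  have hgood_int : 0 < ∫ x in Bsetᶜ, (ν * Zst x - κ₀ * Est x) ∂m := by
    have h := integral_add_compl hBmeas hh_int
    linarith
  -- (6) pick the point
  have hgood : ∀ᵐ x : ↥(galerkinSubspace (Torus.freqBall (d := Fin 3) N)) ∂m,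
      ((x : ↥(Torus.freqBall (d := Fin 3) N) → EuclideanSpace ℂ (Fin 3)) ⟨0, Torus.zero_mem_freqBall N⟩ = 0 ∧
        ∀ t, 0 ≤ t → ∑ k ∈ Torus.freqBall N, ‖Torus.coeffExt (Torus.freqBall N)
          ((galerkinPhaseFlow ν (fourierRestrict (Torus.freqBall N) f) t x :
            ↥(galerkinSubspace (Torus.freqBall (d := Fin 3) N))) :
              ↥(Torus.freqBall (d := Fin 3) N) → EuclideanSpace ℂ (Fin 3)) k‖ ^ 2 ≤ R ^ 2) ∧
      Tendsto (fun i : ℕ => birkhoffAverage ℝ (galerkinPhaseFlow ν (fourierRestrict (Torus.freqBall N) f) 1)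
        (fun y => ∫ s in (0 : ℝ)..1, En (galerkinPhaseFlow ν (fourierRestrict (Torus.freqBall N) f) s y)) i x) atTop (𝓝 (Est x)) ∧
      Tendsto (fun i : ℕ => birkhoffAverage ℝ (galerkinPhaseFlow ν (fourierRestrict (Torus.freqBall N) f) 1)
        (fun y => ∫ s in (0 : ℝ)..1, Bd N (galerkinPhaseFlow ν (fourierRestrict (Torus.freqBall N) f) s y)) i x) atTop (𝓝 (Zst x)) ∧
      ∀ n, Tendsto (fun i : ℕ => birkhoffAverage ℝ (galerkinPhaseFlow ν (fourierRestrict (Torus.freqBall N) f) 1)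
        (fun y => ∫ s in (0 : ℝ)..1, Tl n (galerkinPhaseFlow ν (fourierRestrict (Torus.freqBall N) f) s y)) i x) atTop (𝓝 (Tst n x)) ∧
        Tst n x = Tm n x := by
    have hall : ∀ᵐ x ∂m, ∀ n, Tendsto (fun i : ℕ => birkhoffAverage ℝ (galerkinPhaseFlow ν (fourierRestrict (Torus.freqBall N) f) 1)
        (fun y => ∫ s in (0 : ℝ)..1, Tl n (galerkinPhaseFlow ν (fourierRestrict (Torus.freqBall N) f) s y)) i x) atTop (𝓝 (Tst n x)) ∧
        Tst n x = Tm n x := by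
      rw [ae_all_iff]
      intro n
      filter_upwards [hTconv n, hTm_ae n] with x h1 h2
      exact ⟨h1, h2⟩
    filter_upwards [hconf, hEconv, hZconv, hall] with x h1 h2 h3 h4
    exact ⟨h1, h2, h3, h4⟩
  obtain ⟨x, hxgood, hxB, hxpos⟩ : ∃ x : ↥(galerkinSubspace (Torus.freqBall (d := Fin 3) N)),
      (((x : ↥(Torus.freqBall (d := Fin 3) N) → EuclideanSpace ℂ (Fin 3)) ⟨0, Torus.zero_mem_freqBall N⟩ = 0 ∧
        ∀ t, 0 ≤ t → ∑ k ∈ Torus.freqBall N, ‖Torus.coeffExt (Torus.freqBall N)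
          ((galerkinPhaseFlow ν (fourierRestrict (Torus.freqBall N) f) t x :
            ↥(galerkinSubspace (Torus.freqBall (d := Fin 3) N))) :
              ↥(Torus.freqBall (d := Fin 3) N) → EuclideanSpace ℂ (Fin 3)) k‖ ^ 2 ≤ R ^ 2) ∧
      Tendsto (fun i : ℕ => birkhoffAverage ℝ (galerkinPhaseFlow ν (fourierRestrict (Torus.freqBall N) f) 1)
        (fun y => ∫ s in (0 : ℝ)..1, En (galerkinPhaseFlow ν (fourierRestrict (Torus.freqBall N) f) s y)) i x) atTop (𝓝 (Est x)) ∧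
      Tendsto (fun i : ℕ => birkhoffAverage ℝ (galerkinPhaseFlow ν (fourierRestrict (Torus.freqBall N) f) 1)
        (fun y => ∫ s in (0 : ℝ)..1, Bd N (galerkinPhaseFlow ν (fourierRestrict (Torus.freqBall N) f) s y)) i x) atTop (𝓝 (Zst x)) ∧
      ∀ n, Tendsto (fun i : ℕ => birkhoffAverage ℝ (galerkinPhaseFlow ν (fourierRestrict (Torus.freqBall N) f) 1)
        (fun y => ∫ s in (0 : ℝ)..1, Tl n (galerkinPhaseFlow ν (fourierRestrict (Torus.freqBall N) f) s y)) i x) atTop (𝓝 (Tst n x)) ∧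
        Tst n x = Tm n x) ∧ x ∉ Bset ∧ κ₀ * Est x < ν * Zst x := by
    by_contra hcon
    push Not at hcon
    have hle : (fun x => ν * Zst x - κ₀ * Est x) ≤ᵐ[m.restrict Bsetᶜ] 0 := by
      filter_upwards [ae_restrict_mem hBmeas.compl, ae_restrict_of_ae hgood] with x hxc hxg
      have := hcon x hxg hxc
      simp only [Pi.zero_apply]
      linarith
    have := integral_nonpos_of_ae hle
    linarith
  -- (7) read off the conclusions at the point `x`
  refine ⟨x, hxgood.1.1, hxgood.1.2, Est x, Zst x, by rw [hκ₀] at hxpos; exact hxpos, ?_, ?_, fun n => ⟨Tst n x, ?_, ?_⟩⟩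
  · refine hxgood.2.1.congr fun i => ?_
    rw [birkhoffAverage_timeMean hν.le hg hEnc i x]
  · refine hxgood.2.2.1.congr fun i => ?_
    rw [birkhoffAverage_timeMean hν.le hg (hBdc N) i x]
  · have h1 : x ∉ {x | ((n : ℝ) + 1)⁻¹ < Tm n x} := fun h => hxB (mem_iUnion.2 ⟨n, h⟩)
    rw [(hxgood.2.2.2 n).2]
    exact not_lt.1 h1
  · refine (hxgood.2.2.2 n).1.congr fun i => ?_
    rw [birkhoffAverage_timeMean hν.le hg (hTlc n) i x]

/-- **Deliverable (registered): level-free thresholds exist.** For `ν, ε > 0`, a radius `R` and a schedule `κ` there are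
`n₀` and `L ≥ 1` with `ν (8π²κ(n₀)²R²/L + 2/(n₀+1)) < ε/2` (first `n₀` with `2ν/(n₀+1) < ε/4`, then `L`). [folklore] -/
theorem goodDatum_thresholds_exist :
    ∀ (ν ε R : ℝ) (κ : ℕ → ℕ), 0 < ν → 0 < ε →
      ∃ n₀ L : ℕ, 1 ≤ L ∧ ν * (8 * Real.pi ^ 2 * ((κ n₀ : ℕ) : ℝ) ^ 2 * R ^ 2 / L + 2 * ((n₀ : ℝ) + 1)⁻¹) < ε / 2 := by
  intro ν ε R κ hν hε
  -- `n₀` with `ν · 2/(n₀+1) < ε/4`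
  obtain ⟨n₀, hn₀⟩ := exists_nat_gt (8 * ν / ε)
  have hn₀' : ν * (2 * ((n₀ : ℝ) + 1)⁻¹) < ε / 4 := by
    have h1 : (0 : ℝ) < (n₀ : ℝ) + 1 := by positivity
    rw [div_lt_iff₀ hε] at hn₀
    rw [show ν * (2 * ((n₀ : ℝ) + 1)⁻¹) = 2 * ν / ((n₀ : ℝ) + 1) by ring, div_lt_iff₀ h1]
    nlinarith
  -- `L` with `ν · M/L < ε/4`
  set M : ℝ := 8 * Real.pi ^ 2 * ((κ n₀ : ℕ) : ℝ) ^ 2 * R ^ 2 with hM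
  have hM0 : 0 ≤ M := by positivity
  obtain ⟨L, hL⟩ := exists_nat_gt (max 1 (4 * ν * M / ε))
  have hL1 : (1 : ℝ) < L := (le_max_left _ _).trans_lt hL
  have hL0 : (0 : ℝ) < L := zero_lt_one.trans hL1
  refine ⟨n₀, L, by exact_mod_cast hL1.le, ?_⟩
  have h2 : ν * (M / L) < ε / 4 := by
    have h3 : 4 * ν * M / ε < L := (le_max_right _ _).trans_lt hL
    rw [div_lt_iff₀ hε] at h3
    rw [show ν * (M / L) = ν * M / L by ring, div_lt_iff₀ hL0]
    nlinarith
  calc ν * (M / L + 2 * ((n₀ : ℝ) + 1)⁻¹) = ν * (M / L) + ν * (2 * ((n₀ : ℝ) + 1)⁻¹) := by ring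
    _ < ε / 4 + ε / 4 := add_lt_add h2 hn₀'
    _ = ε / 2 := by ring

end Select

end Summit.AnomalousDissipation.AnomalousDissipation.Theorems.MomentLadder

end
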